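import Literature.NumberTheory.EllipticCurves.ManinConstantFiniteHeightPrimesProofs
import HarnessLib

/-!
# `‖u‖_p ≤ 1` at every prime of FINITE HEIGHT, for an abstract formal-parameter package (lattice-free twin of the tree's
# `ManinConstantFiniteHeightPrimesProofs`) (route `ManinLocalTwoThree`, cruxes C2 stmt-BirchSwinnertonDyer-22967 /
# C3 stmt-…-22968; cell bsd-f2-manin, prover p2 gen 25; CES-discharge programme, stage 3 step (3a))

The tree's `padicNorm_le_one_of_neronLattice_eq_smul_periodLattice_of_formalMul_ne_zero'` proves `‖q‖_p ≤ 1` at a prime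
of finite height with a Honda witness, for the data of the fact `edixhoven_int_of_neronLattice_eq_smul_periodLattice`
(`Λ_{L'} = q·Λ₀(f)`), by first producing (Steps 1–4) the FORMAL PARAMETER `t₀` of `W'` — `t₀ ∈ qℚ⟦q⟧`, `[X¹]t₀ = u`,
`log_{W'}(t₀) = u·Σ aₙ(W')qⁿ/n`, `t₀ ∈ Frac ℤ⟦q⟧` — and then (Steps 5–9: Honda's `[d](t₀) = [n₁](ψ)`, the
Weierstrass-preparation lemma for `[d]` at finite height) concluding `u ∈ ℤ_p`.  THIS FILE isolates Steps 5–9 as a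
theorem about an ABSTRACT formal-parameter package, so that it applies verbatim to the `X₁(N)`-parametrisation of the
Stevens curve (`…StevensShortModelParam`, where `t₀` comes from `Λ₁(f)`):

* `padicNorm_le_one_of_formalParam_of_formalMul_ne_zero` — finite height + Honda witness ⟹ `‖u‖_p ≤ 1`;
* `padicNorm_le_one_of_formalParam_of_not_dvd` (good `p`), `…_of_dvd_of_not_dvd` (multiplicative `p`),
  `…_of_not_additive` (every non-additive `p`) — the tree's wrappers, verbatim with the abstract package.

Proofs: the tree's, verbatim from Step 5 on.  Fact-free; standard axioms; no definitions.  BSD is not proved by this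
file; Manin's conjecture, C2 and C3 are not proved by this file.
[cite: EdixhovenManin1991, Prop. 2] [cite: Honda1970, Thm. 9 (pp. 240–241)] [cite: PastenShimura2024, §10.1 (p. 33)]
[cite: SilvermanAEC2009, IV.1, VII.5]
-/

set_option autoImplicit false
-- lint-debt: the directory name repeats the summit name (sibling precedent `ManinLocalTwoThreeStevensCurveDatum.lean`)
set_option linter.dupNamespace false

noncomputable section

open scoped Classical

open PowerSeries Literature.RingTheory.FormalGroups Literature.NumberTheory.EllipticCurves
open Literature.NumberTheory.EllipticCurves.ModularForms Literature.NumberTheory.EllipticCurves.HondaCongruence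
open _root_.WeierstrassCurve

namespace Summit.BirchSwinnertonDyer.BirchSwinnertonDyer.Theorems.ManinLocalTwoThree.StevensIntegrality

/-! ## §1 Finite height with a Honda witness -/

/-- **`‖u‖_p ≤ 1` at a prime of finite height with a Honda witness, for an abstract formal parameter.**  Let `W'/ℚ`
be globally minimal, `u > 0` rational, `t₀ ∈ qℚ⟦q⟧` with `[X¹]t₀ = u`, `log_{W'}(t₀) = u·Σ aₙ(W')qⁿ/n` and
`t₀·Q' = P'` (`P', Q' ∈ ℤ⟦q⟧`, `Q' ≠ 0`), and let `p` be a prime with (i) `[p]˜ ≠ 0` on the reduction of the minimal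
model and (ii) a Honda witness `Σ aₙ(W')Xⁿ/n = log_{W'}(ψ)`, `ψ ∈ Xℤ_p⟦X⟧`.  Then `‖u‖_p ≤ 1`: with `u = n₁/d` in
lowest terms `[d]_{W'}(t₀) = [n₁]_{W'}(ψ) ∈ ℤ_p⟦q⟧`, and the Weierstrass-preparation lemma
`padicInt_exists_map_eq_of_subst_eq_map` for `[d]` (finite height) gives `t₀ ∈ ℤ_p⟦q⟧`, so `u = [X¹]t₀ ∈ ℤ_p`
(Steps 5–9 of the tree's `…_of_formalMul_ne_zero'`, verbatim). [cite: EdixhovenManin1991, Prop. 2]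
[cite: Honda1970, Thm. 9 (pp. 240–241)] [cite: SilvermanAEC2009, IV.1] -/
theorem padicNorm_le_one_of_formalParam_of_formalMul_ne_zero
    (W' : WeierstrassCurve ℚ) [W'.IsElliptic] [W'.IsGloballyMinimal] {p : ℕ} [Fact p.Prime]
    {u : ℚ} (hCpos : 0 < u) {t₀ : ℚ⟦X⟧} (ht₀0 : constantCoeff t₀ = 0) (ht₀1 : coeff 1 t₀ = u)
    (hlog₀ : W'.formalLog.subst t₀ = C u * PowerSeries.mk fun n ↦ ((W'.LFunction n : ℤ) : ℚ) / n)
    {P' Q' : ℤ⟦X⟧} (hQ' : Q' ≠ 0) (hPQ' : t₀ * Q'.map (Int.castRingHom ℚ) = P'.map (Int.castRingHom ℚ))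
    (hfin : ((integralModelInt W').map (Int.castRingHom (ZMod p))).formalMul p ≠ 0)
    (hψex : ∃ ψ : ℚ_[p]⟦X⟧, constantCoeff ψ = 0 ∧ (∀ n, ‖coeff n ψ‖ ≤ 1) ∧
      (W'.map (algebraMap ℚ ℚ_[p])).formalLog.subst ψ =
        PowerSeries.mk fun k ↦ ((W'.LFunction k : ℤ) : ℚ_[p]) / k) :
    ‖((u : ℚ) : ℚ_[p])‖ ≤ 1 := by
  /- Step 5: base change to `ℚ_p`. -/
  set φ : ℚ →+* ℚ_[p] := algebraMap ℚ ℚ_[p] with hφ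
  set Wp : WeierstrassCurve ℚ_[p] := W'.map φ with hWp
  set ℓ : ℚ_[p]⟦X⟧ := PowerSeries.mk fun k ↦ ((W'.LFunction k : ℤ) : ℚ_[p]) / k with hℓ
  set t' : ℚ_[p]⟦X⟧ := t₀.map φ with ht'
  have ht₀s : HasSubst t₀ := HasSubst.of_constantCoeff_zero' ht₀0
  have ht'0 : constantCoeff t' = 0 := by
    rw [ht', ← coeff_zero_eq_constantCoeff, coeff_map, coeff_zero_eq_constantCoeff, ht₀0, map_zero]
  have ht's : HasSubst t' := HasSubst.of_constantCoeff_zero' ht'0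
  have ht'1 : coeff 1 t' = ((u : ℚ) : ℚ_[p]) := by rw [ht', coeff_map, ht₀1, hφ, eq_ratCast]
  have hℓ' : (PowerSeries.mk fun n ↦ ((W'.LFunction n : ℤ) : ℚ) / n).map φ = ℓ := by
    ext n; rw [coeff_map, coeff_mk, hℓ, coeff_mk, map_div₀, map_natCast, map_intCast]
  have hCu : (C (u : ℚ) : ℚ⟦X⟧).map φ = C ((u : ℚ) : ℚ_[p]) := by
    rw [map_C, eq_ratCast]
  have hlogW : Wp.formalLog.subst t' = C ((u : ℚ) : ℚ_[p]) * ℓ := by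
    rw [ht', hWp, ← W'.map_formalLog φ, ← powerSeries_map_subst ht₀s φ, hlog₀, map_mul, hCu, hℓ']
  set V : WeierstrassCurve ℤ_[p] := (integralModelInt W').map (Int.castRingHom ℤ_[p]) with hV
  have hVc : V.map PadicInt.Coe.ringHom = Wp := map_coe_integralModelInt W'
  have hVt : V.map PadicInt.toZMod = (integralModelInt W').map (Int.castRingHom (ZMod p)) :=
    map_toZMod_integralModelInt W'
  haveI hWpI : Wp.IsIntegral ℤ_[p] := by rw [← hVc]; exact V.isIntegral_map_coe
  have hPV : (V.map PadicInt.toZMod).formalMul p ≠ 0 := by rw [hVt]; exact hfin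
  /- Step 6: Honda — `ℓ = log_{W'}(ψ)` with `ψ ∈ Xℤ_p⟦X⟧`. -/
  obtain ⟨ψ, hψ0, hψi, hψ⟩ := hψex
  have hψ' : Wp.formalLog.subst ψ = ℓ := hψ
  have hψs : HasSubst ψ := HasSubst.of_constantCoeff_zero' hψ0
  have hψI : IsPadicInt ψ := isPadicInt_iff_coeff.mpr hψi
  /- Step 7: `u = n₁ / d` in lowest terms; `[d](t') = [n₁](ψ) =: w ∈ ℤ_p⟦X⟧`. -/
  set d : ℕ := (u : ℚ).den with hd
  have hd0 : 0 < d := (u : ℚ).den_pos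
  have hnum : 0 < (u : ℚ).num := Rat.num_pos.mpr hCpos
  set n₁ : ℕ := (u : ℚ).num.toNat with hn₁
  have hn₁z : ((n₁ : ℕ) : ℤ) = (u : ℚ).num := Int.toNat_of_nonneg hnum.le
  have hdu : (d : ℚ_[p]) * ((u : ℚ) : ℚ_[p]) = (n₁ : ℚ_[p]) := by
    have h : ((u : ℚ)) * d = ((u : ℚ).num : ℚ) := Rat.mul_den_eq_num _
    rw [← hn₁z] at h
    have h' := congrArg (fun r : ℚ ↦ (r : ℚ_[p])) h
    simp only [Rat.cast_mul, Rat.cast_natCast, Int.cast_natCast] at h'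
    rw [mul_comm]
    exact h'
  set w : ℚ_[p]⟦X⟧ := (Wp.formalMul n₁).subst ψ with hw
  have hwI : IsPadicInt w := (Wp.isPadicInt_formalMul n₁).powerSeries_subst hψI hψs
  have hw0 : constantCoeff w = 0 :=
    (Literature.NumberTheory.EllipticCurves.constantCoeff_subst_of_constantCoeff_eq_zero hψ0).trans (Wp.constantCoeff_formalMul n₁)
  have hlogw : Wp.formalLog.subst w = n₁ • ℓ := by
    rw [hw, ← subst_comp_subst_apply (Wp.hasSubst_formalMul n₁) hψs, Wp.formalLog_subst_formalMul n₁,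
      ← coe_substAlgHom hψs, map_nsmul, coe_substAlgHom, hψ']
  have hdt'0 : constantCoeff ((Wp.formalMul d).subst t') = 0 :=
    (Literature.NumberTheory.EllipticCurves.constantCoeff_subst_of_constantCoeff_eq_zero ht'0).trans (Wp.constantCoeff_formalMul d)
  have hlogd : Wp.formalLog.subst ((Wp.formalMul d).subst t') = n₁ • ℓ := by
    rw [← subst_comp_subst_apply (Wp.hasSubst_formalMul d) ht's, Wp.formalLog_subst_formalMul d,
      ← coe_substAlgHom ht's, map_nsmul, coe_substAlgHom, hlogW, nsmul_eq_mul, nsmul_eq_mul,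
      ← mul_assoc, ← map_natCast (C : ℚ_[p] →+* ℚ_[p]⟦X⟧) d, ← map_mul, hdu, map_natCast]
  have hGw : (Wp.formalMul d).subst t' = w :=
    Wp.eq_of_formalLog_subst_eq hdt'0 hw0 (hlogd.trans hlogw.symm)
  /- Step 8: the Weierstrass-preparation lemma for `g = [d]_V` at `t'`. -/
  have halg : (algebraMap ℤ_[p] ℚ_[p] : ℤ_[p] →+* ℚ_[p]) = PadicInt.Coe.ringHom := rfl
  obtain ⟨w₁, hw₁⟩ := isPadicInt_iff_exists_powerSeries_map.mp hwI
  obtain ⟨dd, hdd, hunit⟩ := V.exists_isUnit_coeff_formalMul_subst_of_formalMul_prime_ne_zero hPV hd0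
    (θ := X) constantCoeff_X (by rw [coeff_one_X]; exact isUnit_one)
  rw [powerSeries_subst_X_self] at hunit
  -- the `Frac ℤ_p⟦X⟧`-witness for `t'`
  set Q₁ : ℤ_[p]⟦X⟧ := Q'.map (Int.castRingHom ℤ_[p]) with hQ₁
  set P₁ : ℤ_[p]⟦X⟧ := P'.map (Int.castRingHom ℤ_[p]) with hP₁
  have hintQ : ∀ R : ℤ⟦X⟧, (R.map (Int.castRingHom ℤ_[p])).map (algebraMap ℤ_[p] ℚ_[p]) =
      (R.map (Int.castRingHom ℚ)).map φ := fun R ↦ by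
    ext n
    simp [coeff_map]
  have hQ₁0 : Q₁ ≠ 0 := by
    intro h0
    apply hQ'
    apply PowerSeries.map_injective (Int.castRingHom ℤ_[p]) Int.cast_injective
    rw [← hQ₁, h0, map_zero]
  have hPQ₁ : t' * Q₁.map (algebraMap ℤ_[p] ℚ_[p]) = P₁.map (algebraMap ℤ_[p] ℚ_[p]) := by
    rw [hQ₁, hP₁, hintQ, hintQ, ht', ← map_mul, hPQ']
  have hGz : (V.formalMul d).subst t' = w₁.map (algebraMap ℤ_[p] ℚ_[p]) := by
    rw [← subst_map_algebraMap (V.formalMul d) ht's, halg, map_formalMul, hVc, hGw, ← hw₁]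
  obtain ⟨t₁, ht₁⟩ :=
    Literature.RingTheory.PowerSeries.padicInt_exists_map_eq_of_subst_eq_map hdd hunit ht'0 hGz
      hQ₁0 hPQ₁
  /- Step 9: `u = [X¹](t') ∈ ℤ_p`. -/
  have h1 : (algebraMap ℤ_[p] ℚ_[p]) (coeff 1 t₁) = ((u : ℚ) : ℚ_[p]) := by
    rw [← ht'1, ← ht₁, coeff_map]
  rw [← h1]
  exact PadicInt.norm_le_one _

/-! ## §2 Good and multiplicative primes, all `p` -/

/-- **`‖u‖_p ≤ 1` at every GOOD prime `p`** (`p ∤ Δ_min(W')`), for an abstract formal parameter: finite height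
(`formalMul_prime_map_toZMod_ne_zero'`) and Honda (`exists_padicInt_formalLog_subst_eq_lSeriesLog'`) at every good prime.
[cite: EdixhovenManin1991, Prop. 2] [cite: Honda1970, Thm. 9 (pp. 240–241)] -/
theorem padicNorm_le_one_of_formalParam_of_not_dvd
    (W' : WeierstrassCurve ℚ) [W'.IsElliptic] [W'.IsGloballyMinimal] {p : ℕ} [Fact p.Prime]
    {u : ℚ} (hCpos : 0 < u) {t₀ : ℚ⟦X⟧} (ht₀0 : constantCoeff t₀ = 0) (ht₀1 : coeff 1 t₀ = u)
    (hlog₀ : W'.formalLog.subst t₀ = C u * PowerSeries.mk fun n ↦ ((W'.LFunction n : ℤ) : ℚ) / n)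
    {P' Q' : ℤ⟦X⟧} (hQ' : Q' ≠ 0) (hPQ' : t₀ * Q'.map (Int.castRingHom ℚ) = P'.map (Int.castRingHom ℚ))
    (hgood : ¬ (p : ℤ) ∣ minimalDiscriminantInt W') :
    ‖((u : ℚ) : ℚ_[p])‖ ≤ 1 := by
  refine padicNorm_le_one_of_formalParam_of_formalMul_ne_zero W' hCpos ht₀0 ht₀1 hlog₀ hQ' hPQ' ?_
    (W'.exists_padicInt_formalLog_subst_eq_lSeriesLog' hgood)
  set V : WeierstrassCurve ℤ_[p] := (integralModelInt W').map (Int.castRingHom ℤ_[p]) with hV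
  have hVc : V.map PadicInt.Coe.ringHom = W'.map (algebraMap ℚ ℚ_[p]) := map_coe_integralModelInt W'
  have hVt : V.map PadicInt.toZMod = (integralModelInt W').map (Int.castRingHom (ZMod p)) :=
    map_toZMod_integralModelInt W'
  haveI hEc : (V.map PadicInt.Coe.ringHom).IsElliptic := by rw [hVc]; infer_instance
  haveI hEt' := isElliptic_reduction_of_not_dvd (p := p) W' hgood
  haveI hEt : (V.map PadicInt.toZMod).IsElliptic := by rw [hVt]; infer_instance
  have h := V.formalMul_prime_map_toZMod_ne_zero'
  rwa [hVt] at h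

/-- **`‖u‖_p ≤ 1` at every MULTIPLICATIVE prime `p`** (`p ∣ Δ_min(W')`, `p ∤ c₄(W')`), for an abstract formal parameter:
Honda at a node (`exists_padicInt_formalLog_subst_eq_lSeriesLog_of_dvd_of_not_dvd`) and `[p]˜ ≠ 0` at a node
(`formalMul_prime_map_toZMod_ne_zero_of_nodal`). [cite: EdixhovenManin1991, Prop. 2] [cite: Honda1970, Thm. 9 (pp. 240–241)] -/
theorem padicNorm_le_one_of_formalParam_of_dvd_of_not_dvd
    (W' : WeierstrassCurve ℚ) [W'.IsElliptic] [W'.IsGloballyMinimal] {p : ℕ} [Fact p.Prime]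
    {u : ℚ} (hCpos : 0 < u) {t₀ : ℚ⟦X⟧} (ht₀0 : constantCoeff t₀ = 0) (ht₀1 : coeff 1 t₀ = u)
    (hlog₀ : W'.formalLog.subst t₀ = C u * PowerSeries.mk fun n ↦ ((W'.LFunction n : ℤ) : ℚ) / n)
    {P' Q' : ℤ⟦X⟧} (hQ' : Q' ≠ 0) (hPQ' : t₀ * Q'.map (Int.castRingHom ℚ) = P'.map (Int.castRingHom ℚ))
    (hΔ : (p : ℤ) ∣ minimalDiscriminantInt W') (hc₄ : ¬ (p : ℤ) ∣ (integralModelInt W').c₄) :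
    ‖((u : ℚ) : ℚ_[p])‖ ≤ 1 := by
  refine padicNorm_le_one_of_formalParam_of_formalMul_ne_zero W' hCpos ht₀0 ht₀1 hlog₀ hQ' hPQ' ?_
    (W'.exists_padicInt_formalLog_subst_eq_lSeriesLog_of_dvd_of_not_dvd hΔ hc₄)
  have h := ((integralModelInt W').map (Int.castRingHom ℤ_[p])).formalMul_prime_map_toZMod_ne_zero_of_nodal
    ?_ ?_
  · rwa [map_toZMod_integralModelInt] at h
  · rw [map_toZMod_integralModelInt, map_Δ, eq_intCast, ZMod.intCast_zmod_eq_zero_iff_dvd]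
    exact hΔ
  · rw [map_toZMod_integralModelInt, map_c₄, eq_intCast, Ne, ZMod.intCast_zmod_eq_zero_iff_dvd]
    exact hc₄

/-- **`‖u‖_p ≤ 1` at every prime `p` that is NOT ADDITIVE** (`¬ (p ∣ Δ_min(W') ∧ p ∣ c₄(W'))`: good or
multiplicative reduction), for an abstract formal parameter. [cite: EdixhovenManin1991, Prop. 2] -/
theorem padicNorm_le_one_of_formalParam_of_not_additive
    (W' : WeierstrassCurve ℚ) [W'.IsElliptic] [W'.IsGloballyMinimal] {p : ℕ} [Fact p.Prime]
    {u : ℚ} (hCpos : 0 < u) {t₀ : ℚ⟦X⟧} (ht₀0 : constantCoeff t₀ = 0) (ht₀1 : coeff 1 t₀ = u)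
    (hlog₀ : W'.formalLog.subst t₀ = C u * PowerSeries.mk fun n ↦ ((W'.LFunction n : ℤ) : ℚ) / n)
    {P' Q' : ℤ⟦X⟧} (hQ' : Q' ≠ 0) (hPQ' : t₀ * Q'.map (Int.castRingHom ℚ) = P'.map (Int.castRingHom ℚ))
    (hadd : ¬ ((p : ℤ) ∣ minimalDiscriminantInt W' ∧ (p : ℤ) ∣ (integralModelInt W').c₄)) :
    ‖((u : ℚ) : ℚ_[p])‖ ≤ 1 := by
  by_cases hΔ : (p : ℤ) ∣ minimalDiscriminantInt W'
  · exact padicNorm_le_one_of_formalParam_of_dvd_of_not_dvd W' hCpos ht₀0 ht₀1 hlog₀ hQ' hPQ' hΔ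
      fun hc ↦ hadd ⟨hΔ, hc⟩
  · exact padicNorm_le_one_of_formalParam_of_not_dvd W' hCpos ht₀0 ht₀1 hlog₀ hQ' hPQ' hΔ

end Summit.BirchSwinnertonDyer.BirchSwinnertonDyer.Theorems.ManinLocalTwoThree.StevensIntegrality

end
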